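import Literature.NumberTheory.EllipticCurves.GreenbergVatsal2000.ResidualSelmerGroups
import Literature.NumberTheory.EllipticCurves.Kobayashi2003.SignedSelmer
import Literature.NumberTheory.EllipticCurves.IwasawaTowerTorsionProofs
import Literature.NumberTheory.EllipticCurves.MazurTorsionGaloisStructureProofs
import Literature.NumberTheory.EllipticCurves.PointDivisibilityProofs
import Literature.NumberTheory.EllipticCurves.GaloisActionProofs
import Literature.NumberTheory.GaloisRepresentations.ContinuousH1
import Summits.BirchSwinnertonDyer.Rank1Residual.P2.EmptyCellsAtTwo
import HarnessLib

/-!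
# Residual comparison for the crux `SignedTransportAtTwo` (stmt-BirchSwinnertonDyer-20333, route `ThetaPartnerAtTwo`,
# line `bridge`): the Kummer map `H¹(L, E[p]) → H¹(L, E[p^∞])[p]` is an ISOMORPHISM when `E(L)[p^∞] = 0`, and on the
# theta habitat `Sel⁺(E/ℚ_∞)[2]` is (the image of) a subgroup of the RESIDUAL cohomology `H¹(ℚ_∞, E[2])`
# (lead prover bsd-wall-tp2-p1 g3; `--supports stmt-BirchSwinnertonDyer-20333`; route-independent, closes nothing)

HONEST FRAMING. THEOREMS ONLY; nothing about any curve's Selmer group is asserted beyond what is proved; BSD is not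
proved by any of this. No import of any route file.

WHAT. Greenberg–Vatsal (Invent. Math. 142 (2000), p. 3 and Prop. (2.8)) and B. D. Kim (Asian J. Math. 13 (2009),
Prop. 2.10) compare `Sel(E/ℚ_∞)[p]` with a Selmer group of the RESIDUAL representation `E[p]` through the cohomology
sequence of `0 → E[p] → E[p^∞] →ᵖ E[p^∞] → 0` over `ℚ_∞`, using `E(ℚ_∞)[p] = 0`. This file proves that step for
Mathlib's continuous cohomology (explicit continuous cocycles, `Literature.NumberTheory.GaloisRepresentations.ContinuousH1`):

* `§1` (any topological group `G`, discrete `G`-modules `N ↪ M` along an equivariant injection `i`):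
  `pushH1_injective_of_saturated` — `i_* : H¹(G, N) → H¹(G, M)` is injective as soon as every `m ∈ M` with all
  `g • m − m ∈ i(N)` lies in `i(N)`; `mem_range_pushH1_of_nsmul_eq_zero` — if `i(N) ⊇ M[p]`, `p·M = M` and the orbit
  maps `g ↦ g • m` are continuous, every `p`-torsion class of `H¹(G, M)` is in the image of `i_*`;
* `§2` (any number field `K`, any `E/K`, any prime `p`, any subgroup `H ≤ Γ_K` with `E[p^∞]^H = 0`):
  `pushH1_torsionBy_injective`, `range_pushH1_torsionBy_eq` — `H¹(H, E[p^∞][p]) ≅ H¹(H, E[p^∞])[p]`;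
* `§3` (the theta habitat): for `W/ℚ` good supersingular at `2` (so `W[2]` irreducible, `W(ℚ)[2] = 0`,
  `W(ℚ_∞)[2^∞] = 0` by `fixedPoints_kerSubgroup_geomPrimaryTorsion_eq_bot`) and ANY `ℤ₂`-extension `κ`, the `2`-torsion
  of Kobayashi's `Sel⁺(W/ℚ_∞)` is finite iff its preimage in `H¹(ℚ_∞, W[2^∞][2])` is finite
  (`finite_signedSelmerInfty_twoTorsion_iff_finite_comap`) — the residual reformulation of the registered stub of line
  `bridge` (sel2), with no new definition.

References: [GreenbergVatsal2000] p. 3, Prop. (2.8); [BDKim2009] Prop. 2.10; [GreenbergLNM1716] §1 p. 62;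
[SerreGaloisCohomology1997] I.§2.2, I.§5.1; [Kobayashi2003] Def. 1.1.
-/

set_option autoImplicit false
-- D-0017: single-problem summit, so `Summit.BirchSwinnertonDyer.BirchSwinnertonDyer.…` repeats a namespace BY DESIGN.
set_option linter.dupNamespace false

noncomputable section

open scoped Classical AddSubgroup

open WeierstrassCurve NumberField Literature Literature.NumberTheory.EllipticCurves
  Literature.NumberTheory.GaloisRepresentations Literature.NumberTheory.EllipticCurves.Rank1Residual
  Literature.NumberTheory.EllipticCurves.Kobayashi2003 Literature.NumberTheory.EllipticCurves.GreenbergVatsal2000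
  ZpExtension

namespace Summit.BirchSwinnertonDyer.BirchSwinnertonDyer.Theorems.SignedTransportAtTwo

universe u

/-! ## §1. Kummer-type lemmas for continuous `H¹` of discrete modules -/

section Generic

variable {G : Type u} [Group G] [TopologicalSpace G] [IsTopologicalGroup G]
variable {M : Type u} [AddCommGroup M] [DistribMulAction G M] [TopologicalSpace M] [DiscreteTopology M]
variable {N : Type u} [AddCommGroup N] [DistribMulAction G N] [TopologicalSpace N] [DiscreteTopology N]
variable (i : N →+ M) (hi : ∀ (g : G) (x : N), i (g • x) = g • i x)

/-- The map `i_* : H¹(G, N) → H¹(G, M)` on explicit cocycles: `i_*[φ] = [i ∘ φ]`. [folklore] -/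
theorem resH1Hom_id_oneCocycleClass (φ : contOneCocycles (discreteTopRep G N)) :
    resH1Hom (ContinuousMonoidHom.id G) i hi (oneCocycleClass _ φ) =
      oneCocycleClass (discreteTopRep G M)
        (contOneCocycles.pullback (ContinuousMonoidHom.id G)
          (resHomOfEquivariant (ContinuousMonoidHom.id G) i hi) φ) :=
  map_oneCocycleClass (discreteTopRep G N) (ContinuousMonoidHom.id G)
    (resHomOfEquivariant (ContinuousMonoidHom.id G) i hi) φ

/-- **`i_*` is injective when `i(N)` is saturated for principal cocycles**: if every `m ∈ M` all of whose
`g • m − m` lie in `i(N)` lies in `i(N)` itself (e.g. `N = M[p]` and `M^G = 0`), then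
`i_* : H¹(G, N) → H¹(G, M)` is injective — a cocycle of `N` that becomes the coboundary of `m` in `M` is the coboundary
of `i⁻¹ m` in `N`. Serre, *Galois Cohomology*, I.§5.1. [cite: SerreGaloisCohomology1997, I.§2.2 and I.§5.1] -/
theorem pushH1_injective_of_saturated (hinj : Function.Injective i)
    (hsat : ∀ m : M, (∀ g : G, g • m - m ∈ Set.range i) → m ∈ Set.range i) :
    Function.Injective (resH1Hom (ContinuousMonoidHom.id G) i hi) := by
  rw [injective_iff_map_eq_zero]
  intro c hc
  obtain ⟨φ, rfl⟩ := oneCocycleClass_surjective _ c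
  rw [resH1Hom_id_oneCocycleClass, oneCocycleClass_eq_zero_iff] at hc
  obtain ⟨v, hv⟩ := hc
  have hv' : ∀ g : G, i (φ.1 g) = g • v - v := fun g ↦ by
    have := hv g
    rw [contOneCocycles.pullback_apply] at this
    exact this
  obtain ⟨n, rfl⟩ := hsat v fun g ↦ ⟨φ.1 g, hv' g⟩
  rw [oneCocycleClass_eq_zero_iff]
  refine ⟨n, fun g ↦ hinj ?_⟩
  change i (φ.1 g) = i (g • n - n)
  rw [hv' g, map_sub, hi]

/-- **Every `p`-torsion class of `H¹(G, M)` comes from `H¹(G, N)` when `i(N) ⊇ M[p]` and `p·M = M`** (orbit maps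
continuous): if `p[φ] = 0` then `p φ = ∂m`, `m = p m'`, and `φ − ∂m'` is a continuous cocycle with values in
`M[p] ⊆ i(N)`. The surjectivity half of `H¹(G, M[p]) ≅ H¹(G, M)[p]` from `0 → M[p] → M →ᵖ M → 0`.
Serre, *Galois Cohomology*, I.§2.2. [cite: SerreGaloisCohomology1997, I.§2.2 and I.§5.1] -/
theorem mem_range_pushH1_of_nsmul_eq_zero {p : ℕ} (hinj : Function.Injective i)
    (hrange : ∀ m : M, p • m = 0 → m ∈ Set.range i) (hdiv : ∀ m : M, ∃ m' : M, p • m' = m)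
    (hcont : ∀ m : M, Continuous fun g : G ↦ g • m)
    {c : discreteH1 G M} (hc : p • c = 0) :
    c ∈ (resH1Hom (ContinuousMonoidHom.id G) i hi).range := by
  obtain ⟨φ, rfl⟩ := oneCocycleClass_surjective _ c
  -- `p φ` is principal
  have hpφ : oneCocycleClass (discreteTopRep G M) ((p : ℤ) • φ) = 0 := by
    rw [oneCocycleClass_smul, Nat.cast_smul_eq_nsmul]
    exact hc
  rw [oneCocycleClass_eq_zero_iff] at hpφ
  obtain ⟨m, hm⟩ := hpφ
  obtain ⟨m', rfl⟩ := hdiv m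
  -- the corrected cocycle `ψ = φ - ∂m'` takes values in `M[p] ⊆ i(N)`
  let ψM : G → M := fun g ↦ φ.1 g - (g • m' - m')
  have hψM : ∀ g, p • ψM g = 0 := fun g ↦ by
    have h1 : ((p : ℤ) • φ).1 g = g • (p • m') - p • m' := hm g
    have h2 : (p : ℤ) • φ.1 g = g • (p • m') - p • m' := h1
    rw [natCast_zsmul] at h2
    change p • (φ.1 g - (g • m' - m')) = 0
    rw [smul_sub, h2, smul_sub, smul_comm p g m']
    exact sub_self _
  have hψmem : ∀ g, ψM g ∈ Set.range i := fun g ↦ hrange _ (hψM g)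
  choose ψN hψN using hψmem
  have hψMcont : Continuous ψM :=
    (φ.1.continuous.sub ((hcont m').sub continuous_const))
  have hψNcont : Continuous ψN := by
    refine continuous_discrete_rng.mpr fun n ↦ ?_
    have hset : ψN ⁻¹' {n} = ψM ⁻¹' {i n} := by
      ext g
      simp only [Set.mem_preimage, Set.mem_singleton_iff]
      constructor
      · intro h; rw [← hψN g, h]
      · intro h; exact hinj (by rw [hψN g, h])
    rw [hset]
    exact (isOpen_discrete _).preimage hψMcont
  -- `ψN` is a cocycle of `N` (checked after applying the injective `i`)
  have hψNcoc : (⟨ψN, hψNcont⟩ : C(G, N)) ∈ contOneCocycles (discreteTopRep G N) := by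
    intro g h
    apply hinj
    change i (ψN (g * h)) = i (ψN g + g • ψN h)
    rw [map_add, hi, hψN, hψN, hψN]
    change φ.1 (g * h) - (((g * h) • m') - m') = φ.1 g - (g • m' - m') + g • (φ.1 h - (h • m' - m'))
    have hφ : φ.1 (g * h) = φ.1 g + g • φ.1 h := φ.2 g h
    rw [hφ, mul_smul, smul_sub, smul_sub]
    abel
  refine ⟨oneCocycleClass _ ⟨⟨ψN, hψNcont⟩, hψNcoc⟩, ?_⟩
  rw [resH1Hom_id_oneCocycleClass, ← sub_eq_zero, ← oneCocycleClass_sub, oneCocycleClass_eq_zero_iff]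
  refine ⟨-m', fun g ↦ ?_⟩
  change i (ψN g) - φ.1 g = g • (-m') - (-m')
  rw [hψN]
  change φ.1 g - (g • m' - m') - φ.1 g = g • (-m') - (-m')
  rw [smul_neg]
  abel

/-- Classes of `H¹(G, N)` are killed by `p` when `N` is: `p[φ] = [p φ] = 0`. [folklore] -/
theorem nsmul_discreteH1_eq_zero_of_forall {p : ℕ} (hN : ∀ n : N, p • n = 0) (c : discreteH1 G N) : p • c = 0 := by
  obtain ⟨φ, rfl⟩ := oneCocycleClass_surjective _ c
  rw [← Nat.cast_smul_eq_nsmul ℤ, ← oneCocycleClass_smul]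
  have h0 : (p : ℤ) • φ = 0 := by
    apply Subtype.ext
    ext g
    change (p : ℤ) • φ.1 g = 0
    rw [natCast_zsmul]
    exact hN _
  rw [h0, oneCocycleClass_zero]

/-- An orbit map `g ↦ g • x` into a discrete space is continuous when the stabiliser of `x` is open (each fibre is
empty or a left coset of the stabiliser). Serre, *Galois Cohomology*, II.§1 (discrete modules). [folklore] -/
theorem continuous_smul_const_of_isOpen_stabilizer {X : Type*} [MulAction G X] [TopologicalSpace X]
    [DiscreteTopology X] (x : X) (hx : IsOpen ((MulAction.stabilizer G x : Subgroup G) : Set G)) :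
    Continuous fun g : G ↦ g • x := by
  refine continuous_discrete_rng.mpr fun y ↦ ?_
  by_cases hy : ∃ g₀ : G, g₀ • x = y
  · obtain ⟨g₀, rfl⟩ := hy
    have hset : (fun g : G ↦ g • x) ⁻¹' {g₀ • x} = (fun g : G ↦ g₀⁻¹ * g) ⁻¹' (MulAction.stabilizer G x : Set G) := by
      ext g
      simp only [Set.mem_preimage, Set.mem_singleton_iff, SetLike.mem_coe, MulAction.mem_stabilizer_iff, mul_smul]
      rw [inv_smul_eq_iff]
    rw [hset]
    exact hx.preimage (continuous_const.mul continuous_id)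
  · have hset : (fun g : G ↦ g • x) ⁻¹' {y} = ∅ := by
      ext g
      simp only [Set.mem_preimage, Set.mem_singleton_iff, Set.mem_empty_iff_false, iff_false]
      exact fun h ↦ hy ⟨g, h⟩
    rw [hset]
    exact isOpen_empty

end Generic


/-! ## §2. `H¹(H, E[p^∞][p]) ≅ H¹(H, E[p^∞])[p]` for `H ≤ Γ_K` with `E[p^∞]^H = 0` -/

section Curve

variable {K : Type u} [Field K] [NumberField K] (W : WeierstrassCurve K) [W.IsElliptic] (p : ℕ) [Fact p.Prime]
  (H : Subgroup (Field.absoluteGaloisGroup K))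

omit [NumberField K] [W.IsElliptic] [Fact p.Prime] in
/-- The inclusion `E[p^∞][p] ↪ E[p^∞]` is `Γ_K`-equivariant (same points). [folklore] -/
theorem subtype_torsionBy_smul (g : Field.absoluteGaloisGroup K) (x : ↥((↥(W.geomPrimaryTorsion p))[(p : ℤ)])) :
    ((↥(W.geomPrimaryTorsion p))[(p : ℤ)]).subtype (g • x) = g • ((↥(W.geomPrimaryTorsion p))[(p : ℤ)]).subtype x :=
  rfl

omit [NumberField K] in
/-- `E[p^∞]` is `p`-divisible: `p · E[p^∞] = E[p^∞]` (from `[p] : E(K̄) ↠ E(K̄)`, `zsmul_geomPoints_surjective_holds`;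
a `p`-th root of a `p`-power-torsion point is `p`-power torsion). Silverman, *AEC*, III.§7. [folklore] -/
theorem exists_nsmul_eq_geomPrimaryTorsion (m : ↥(W.geomPrimaryTorsion p)) :
    ∃ m' : ↥(W.geomPrimaryTorsion p), p • m' = m := by
  have hp : p.Prime := Fact.out
  obtain ⟨P, hP⟩ := W.zsmul_geomPoints_surjective_holds (n := (p : ℤ)) (by exact_mod_cast hp.ne_zero) (m : geomPoints W)
  have hP' : p • P = (m : geomPoints W) := by rw [← natCast_zsmul]; exact hP
  obtain ⟨k, hk⟩ := (AddCommGroup.mem_primaryComponent (p := p)).mp m.2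
  have hPmem : P ∈ W.geomPrimaryTorsion p := by
    rw [AddCommGroup.mem_primaryComponent]
    refine ⟨k + 1, ?_⟩
    rw [pow_succ, mul_smul, hP']
    exact hk
  exact ⟨⟨P, hPmem⟩, Subtype.ext (by rw [AddSubmonoidClass.coe_nsmul]; exact hP')⟩

omit [NumberField K] [W.IsElliptic] [Fact p.Prime] in
/-- The orbit maps `h ↦ h • m` of `H ≤ Γ_K` on `E[p^∞]` are continuous (`E(K̄)` is a discrete `Γ_K`-module:
`isOpen_stabilizer_point_holds`). Serre, *Galois Cohomology*, II.§1. [folklore] -/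
theorem continuous_subgroup_smul_geomPrimaryTorsion (m : ↥(W.geomPrimaryTorsion p)) :
    Continuous fun h : H ↦ h • m := by
  have hc : Continuous fun g : Field.absoluteGaloisGroup K ↦ g • (m : geomPoints W) :=
    continuous_smul_const_of_isOpen_stabilizer (G := Field.absoluteGaloisGroup K) (m : geomPoints W)
      (isOpen_stabilizer_point_holds W (m : geomPoints W))
  refine continuous_induced_rng.mpr ?_
  exact hc.comp continuous_subtype_val

variable {W p H}

omit [NumberField K] [W.IsElliptic] [Fact p.Prime] in
/-- **`H¹(H, E[p^∞][p]) → H¹(H, E[p^∞])` is injective when `E[p^∞]^H = 0`**: a point `m` all of whose `h • m − m`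
are `p`-torsion has `p m ∈ E[p^∞]^H = 0`. GV p. 3 / Kim Prop. 2.10 (the step "`E(ℚ_∞)[p] = 0`").
[cite: GreenbergVatsal2000, p. 3 (proof of Thm. (1.4))] [cite: BDKim2009, Prop. 2.10] -/
theorem pushH1_torsionBy_injective (hfix : FixedPoints.addSubgroup H (↥(W.geomPrimaryTorsion p)) = ⊥) :
    Function.Injective (pushH1 H ((↥(W.geomPrimaryTorsion p))[(p : ℤ)]).subtype (subtype_torsionBy_smul W p)) := by
  refine pushH1_injective_of_saturated _ _ Subtype.val_injective fun m hm ↦ ?_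
  have hpm : p • m ∈ FixedPoints.addSubgroup H (↥(W.geomPrimaryTorsion p)) := by
    rw [FixedPoints.mem_addSubgroup]
    intro h
    obtain ⟨x, hx⟩ := hm h
    have hx0 : p • (h • m - m) = 0 := by
      rw [← hx]
      have := AddSubgroup.torsionBy.nsmul x
      exact congrArg Subtype.val this
    rw [smul_sub, sub_eq_zero, smul_comm] at hx0
    exact hx0
  rw [hfix, AddSubgroup.mem_bot] at hpm
  exact ⟨⟨m, AddSubgroup.torsionBy.nsmul_iff.mpr hpm⟩, rfl⟩

omit [NumberField K] in
/-- **The image of `H¹(H, E[p^∞][p]) → H¹(H, E[p^∞])` is exactly the `p`-torsion `H¹(H, E[p^∞])[p]`** (any `H`;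
`E[p^∞]` is `p`-divisible and a discrete `Γ_K`-module). GV p. 3 / Kim Prop. 2.10.
[cite: GreenbergVatsal2000, p. 3 (proof of Thm. (1.4))] [cite: BDKim2009, Prop. 2.10] -/
theorem mem_range_pushH1_torsionBy_iff (c : subgroupH1 H (↥(W.geomPrimaryTorsion p))) :
    c ∈ (pushH1 H ((↥(W.geomPrimaryTorsion p))[(p : ℤ)]).subtype (subtype_torsionBy_smul W p)).range ↔ p • c = 0 := by
  constructor
  · rintro ⟨c', rfl⟩
    rw [← map_nsmul, nsmul_discreteH1_eq_zero_of_forall (fun n ↦ AddSubgroup.torsionBy.nsmul n), map_zero]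
  · intro hc
    exact mem_range_pushH1_of_nsmul_eq_zero _ _ Subtype.val_injective
      (fun m hm ↦ ⟨⟨m, AddSubgroup.torsionBy.nsmul_iff.mpr hm⟩, rfl⟩)
      (exists_nsmul_eq_geomPrimaryTorsion W p) (continuous_subgroup_smul_geomPrimaryTorsion W p H) hc

end Curve

/-! ## §3. The theta habitat: `Sel⁺(W/ℚ_∞)[2]` against the residual cohomology `H¹(ℚ_∞, W[2^∞][2])` -/

section Habitat

variable (W : WeierstrassCurve ℚ) [W.IsElliptic] [W.IsGloballyMinimal]

/-- On the habitat `W(ℚ)[2] = 0`: good supersingular at `2` ⇒ `W[2]` irreducible (`P2.irr_two_of_goodSS_two`) ⇒ no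
rational point of order `2` (`not_exists_addOrderOf_eq_of_hasIrreducibleModPGaloisRep`). [folklore] -/
theorem eq_zero_of_two_nsmul_eq_zero_of_goodSS (hss : GoodSS W 2) (P : W.toAffine.Point) (hP : 2 • P = 0) : P = 0 := by
  by_contra hne
  exact not_exists_addOrderOf_eq_of_hasIrreducibleModPGaloisRep W (Summit.BirchSwinnertonDyer.Rank1Residual.P2.irr_two_of_goodSS_two W hss)
    ⟨P, addOrderOf_eq_prime hP hne⟩

/-- On the habitat `W(ℚ_∞)[2^∞] = 0` for EVERY `ℤ₂`-extension `ℚ_∞/ℚ` (`fixedPoints_kerSubgroup_geomPrimaryTorsion_eq_bot`: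
a pro-`2` group acting on a non-zero `2`-group has a non-zero fixed point, and `W(ℚ)[2] = 0`).
[cite: GreenbergLNM1716, §1 p. 62; §4 p. 109] -/
theorem fixedPoints_kerSubgroup_eq_bot_of_goodSS (hss : GoodSS W 2) (κ : ZpExtension ℚ 2) :
    FixedPoints.addSubgroup κ.kerSubgroup (↥(W.geomPrimaryTorsion 2)) = ⊥ := by
  refine W.fixedPoints_kerSubgroup_geomPrimaryTorsion_eq_bot κ fun P hP ↦ ?_
  -- (the `DecidableEq ℚ` instance inside the group law of `E(ℚ)` differs syntactically between the two lemmas)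
  have hP' : (2 : ℕ) • P = 0 := by convert hP
  exact eq_zero_of_two_nsmul_eq_zero_of_goodSS W hss P hP'

/-- **Residual reformulation of sel2 (no new definition).** On the habitat, for any `ℤ₂`-extension `κ` and either sign
`ε`, the `2`-torsion of Kobayashi's `Sel^ε(W/ℚ_∞)` is finite iff the preimage of `Sel^ε(W/ℚ_∞)` under the (injective)
Kummer map `H¹(ℚ_∞, W[2^∞][2]) → H¹(ℚ_∞, W[2^∞])` is finite: that map is a bijection onto `H¹(ℚ_∞, W[2^∞])[2]`
(`pushH1_torsionBy_injective`, `mem_range_pushH1_torsionBy_iff`). GV p. 3 / Kim Prop. 2.10 READ AT `2`.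
[cite: GreenbergVatsal2000, p. 3 and Prop. (2.8)] [cite: BDKim2009, Prop. 2.10] [cite: Kobayashi2003, Def. 1.1] -/
theorem finite_signedSelmerInfty_twoTorsion_iff_finite_comap (hss : GoodSS W 2) (κ : ZpExtension ℚ 2) (ε : ℤˣ) :
    {s : signedSelmerInfty W κ ε | (2 : ℕ) • s = 0}.Finite ↔
      ((signedSelmerInfty W κ ε).comap
        (pushH1 κ.kerSubgroup ((↥(W.geomPrimaryTorsion 2))[(2 : ℤ)]).subtype (subtype_torsionBy_smul W 2)) :
          Set (subgroupH1 κ.kerSubgroup ↥((↥(W.geomPrimaryTorsion 2))[(2 : ℤ)]))).Finite := by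
  set π := pushH1 κ.kerSubgroup ((↥(W.geomPrimaryTorsion 2))[(2 : ℤ)]).subtype (subtype_torsionBy_smul W 2)
    with hπ
  have hinj : Function.Injective π := pushH1_torsionBy_injective (fixedPoints_kerSubgroup_eq_bot_of_goodSS W hss κ)
  have hrange : ∀ c, c ∈ π.range ↔ (2 : ℕ) • c = 0 := mem_range_pushH1_torsionBy_iff
  set S2 : Set (signedSelmerInfty W κ ε) := {s | (2 : ℕ) • s = 0} with hS2
  -- the comparison map `Sel.comap π → {s ∈ Sel | 2 s = 0}`
  have hmemS2 : ∀ x : ↥((signedSelmerInfty W κ ε).comap π), (⟨π x, x.2⟩ : signedSelmerInfty W κ ε) ∈ S2 := fun x ↦ by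
    change (2 : ℕ) • (⟨π x, x.2⟩ : signedSelmerInfty W κ ε) = 0
    apply Subtype.ext
    rw [AddSubgroupClass.coe_nsmul, ZeroMemClass.coe_zero]
    exact (hrange (π x.1)).mp ⟨x.1, rfl⟩
  let f : ↥((signedSelmerInfty W κ ε).comap π) → S2 := fun x ↦ ⟨⟨π x, x.2⟩, hmemS2 x⟩
  have hf_inj : Function.Injective f := fun x y hxy ↦ by
    apply Subtype.ext
    apply hinj
    have := congrArg (fun z : S2 ↦ ((z.1 : signedSelmerInfty W κ ε) : subgroupH1 κ.kerSubgroup ↥(W.geomPrimaryTorsion 2))) hxy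
    exact this
  have hf_surj : Function.Surjective f := fun s ↦ by
    have hs2 : (2 : ℕ) • ((s.1 : signedSelmerInfty W κ ε) : subgroupH1 κ.kerSubgroup ↥(W.geomPrimaryTorsion 2)) = 0 := by
      have h := s.2
      change (2 : ℕ) • (s.1 : signedSelmerInfty W κ ε) = 0 at h
      have := congrArg (fun z : signedSelmerInfty W κ ε ↦ (z : subgroupH1 κ.kerSubgroup ↥(W.geomPrimaryTorsion 2))) h
      simpa only [AddSubgroupClass.coe_nsmul, ZeroMemClass.coe_zero] using this
    obtain ⟨c', hc'⟩ := (hrange _).mpr hs2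
    refine ⟨⟨c', ?_⟩, ?_⟩
    · change π c' ∈ signedSelmerInfty W κ ε
      rw [hc']
      exact s.1.2
    · apply Subtype.ext; apply Subtype.ext
      exact hc'
  constructor
  · intro hfin
    haveI : Finite S2 := hfin.to_subtype
    haveI : Finite ↥((signedSelmerInfty W κ ε).comap π) := Finite.of_injective f hf_inj
    exact Set.toFinite _
  · intro hfin
    haveI : Finite ↥((signedSelmerInfty W κ ε).comap π) := hfin.to_subtype
    haveI : Finite S2 := Finite.of_surjective f hf_surj
    exact Set.toFinite _

end Habitat

end Summit.BirchSwinnertonDyer.BirchSwinnertonDyer.Theorems.SignedTransportAtTwo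

end
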